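import Summits.CriticalPhenomena.PercolationContinuityZ3.Theorems.Transplant.Slab111Eq12
import HarnessLib

/-!
# HEXAGONAL SHADOWS XIV — the chain eq. (1) ⇒ (12) ⇒ (13) ⇒ NODE A with the normalisation `u_n ≤ n/4` (no touching of `S_{3n}` and `B'_n`)

builds on p205010 (kernel theorem, internal audit signed; external expert review pending) — NOT used in this file.
Lane `prim-bschramm`, seat `prim-bschramm-p2` (gen 32; class C1b; memo `HOME/bschramm/P2-LATTICES.md` §115); helper file
(`--supports stmt-CriticalPhenomena-4575 --as helper`).  Slab original: `Literature/…/SlabCriticalityChain4` ("DST Thm. 1 from the Gluing Lemma in the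
range `u_{3n} + 1 ≤ n`").

WHY.  DST only require `u_n ≤ n/3` of the sequence of eq. (1); with `u_{3n} = n` the inner set `S_{3n} = B_{u_{3n}}` TOUCHES the auxiliary box
`B'_n`, a case the printed proof of the Gluing Lemma does not discuss and which the slab formalisation avoided by taking `u_n ≤ n/4` (an equally
admissible normalisation of the diagonal extraction).  The gen-31 hexagonal chain («HexShadowFaceCriterion», «HexShadowTwoBlock»,
«HexShadowUniqueConn») was typed with `3 u_n ≤ n`; this file re-types it with `4 u_n ≤ n`, so that the hexagonal Gluing Lemma («HexShadowGluing»,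
next file) can be stated in the non-touching range.  The proofs are those of gen 31 verbatim (constant `3 ↦ 4`):
* §1 the diagonal extraction with an arbitrary normalisation `K u_n ≤ n` (`exists_seq_tendsto_one_of_liminf_mul`);
* §2 the sub-nodes `UniqueConnLikely4` (eq. (1)), `Eq12Likely4` (eq. (12)), `TwoBlockLikely4` (eq. (13), face version) — internal obligations,
  predicates of `Φ`, never asserted;
* §3 **`uniqueConnLikely4_of_uniqueness`** (a.s. uniqueness ⇒ eq. (1) with `4 u_n ≤ n`), **`twoBlockLikely4_of_eq12Likely4`** (the lifted side mirror),
  **`faceGoodEventLikely_of_subnodes4`** (NODE A from eq. (1) and (13)); hence `θ_v(p_c) = 0` from `Eq12Likely4` for connected graphs with a.s. uniqueness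
  (`theta_criticalProb_eq_zero_of_eq12Likely4`) and the `(111)`-film corollary.
[cite: DuminilCopinSidoraviciusTassion2016, §2.1 eqs. (1), (12), (13), §2.2] [cite: GrimmettPercolation1999, §1.6 p. 16]
-/

noncomputable section

namespace Summit.CriticalPhenomena.PercolationContinuityZ3.Theorems.Transplant

open MeasureTheory Literature.Probability.Percolation Literature.Probability.LatticeModels SimpleGraph Filter
open Literature.Barriers.CriticalPhenomena (BurtonKeane1989_atMostOneInfiniteCluster_holds)
open scoped Classical Topology

/-! ## §1 Diagonal extraction with normalisation `K u_n ≤ n` -/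

/-- **Diagonal extraction**: if `0 ≤ a_v(n) ≤ 1`, `liminf_n a_v(n) ≥ g(v)`, `g ≤ 1`, `g(v) → 1`, then `a_{u_n}(n) → 1` along some `u` with `K u_n ≤ n`
(verbatim `exists_seq_tendsto_one_of_liminf` of `SlabCriticalityInputs` with `3 ↦ K`). [cite: DuminilCopinSidoraviciusTassion2016, §2.1 (eq. (1))] -/
theorem exists_seq_tendsto_one_of_liminf_mul (K : ℕ) {a : ℕ → ℕ → ℝ} {g : ℕ → ℝ}
    (ha0 : ∀ v n, 0 ≤ a v n) (ha1 : ∀ v n, a v n ≤ 1) (hg1 : ∀ v, g v ≤ 1)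
    (hlim : ∀ v, ∀ ε : ℝ, 0 < ε → ∀ᶠ n in atTop, g v - ε ≤ a v n) (hg : Tendsto g atTop (𝓝 1)) :
    ∃ u : ℕ → ℕ, (∀ n, K * u n ≤ n) ∧ Tendsto (fun n => a (u n) n) atTop (𝓝 1) := by
  classical
  let Q : ℕ → ℕ → Prop := fun v n => K * v ≤ n ∧ ∀ m, n ≤ m → ∀ w, w ≤ v → g w - 1 / ((w : ℝ) + 1) ≤ a w m
  have hQ0 : ∀ n, Q 0 n := by
    intro n
    refine ⟨by simp, fun m _ w hw => ?_⟩
    obtain rfl : w = 0 := Nat.le_zero.1 hw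
    have h1 := hg1 0
    have h2 := ha0 0 m
    norm_num
    linarith
  let u : ℕ → ℕ := fun n => Nat.findGreatest (fun v => Q v n) n
  have hspec : ∀ n, Q (u n) n := fun n => Nat.findGreatest_spec (P := fun v => Q v n) (Nat.zero_le n) (hQ0 n)
  refine ⟨u, fun n => (hspec n).1, ?_⟩
  have hu : Tendsto u atTop atTop := by
    refine Filter.tendsto_atTop_atTop.2 fun v => ?_
    have hev : ∀ w ∈ {w | w ≤ v}, ∀ᶠ n in atTop, g w - 1 / ((w : ℝ) + 1) ≤ a w n :=
      fun w _ => hlim w (1 / ((w : ℝ) + 1)) (by positivity)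
    obtain ⟨N, hN⟩ := Filter.eventually_atTop.1 ((Set.finite_le_nat v).eventually_all.2 hev)
    refine ⟨max N (max (K * v) v), fun n hn => ?_⟩
    have hQ : Q v n := ⟨(le_max_left _ _).trans ((le_max_right _ _).trans hn), fun m hm w hw => hN m (le_of_max_le_left (hn.trans hm)) w hw⟩
    exact Nat.le_findGreatest (P := fun v => Q v n) ((le_max_right _ _).trans ((le_max_right _ _).trans hn)) hQ
  have hlow : ∀ n, g (u n) - 1 / ((u n : ℝ) + 1) ≤ a (u n) n := fun n => (hspec n).2 n le_rfl (u n) le_rfl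
  have hg' : Tendsto (fun n => g (u n) - 1 / ((u n : ℝ) + 1)) atTop (𝓝 1) := by
    have h1 : Tendsto (fun n => g (u n)) atTop (𝓝 1) := hg.comp hu
    have h2 : Tendsto (fun n => 1 / ((u n : ℝ) + 1)) atTop (𝓝 0) := (tendsto_one_div_add_atTop_nhds_zero_nat (𝕜 := ℝ)).comp hu
    simpa using h1.sub h2
  exact tendsto_of_tendsto_of_tendsto_of_le_of_le hg' tendsto_const_nhds hlow fun n => ha1 _ _

namespace HexShadow

variable {V : Type} {G : SimpleGraph V} (Φ : HexShadow G)

/-! ## §2 The sub-nodes with `4 u_n ≤ n` -/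

/-- **SUB-NODE A1 (eq. (1)) with `u_n ≤ n/4`**: if `θ_v(p) > 0` there is `u : ℕ → ℕ` with `4 u_n ≤ n` and
`P_p[hexBall c u_n ⟷^{!hexBall c n!} hexSphere c n] → 1`.  Internal obligation (PROVED below from a.s. uniqueness), never asserted.
[cite: DuminilCopinSidoraviciusTassion2016, §2.1 eq. (1)] -/
def UniqueConnLikely4 {V : Type} {G : SimpleGraph V} (Φ : HexShadow G) [Countable V] : Prop :=
  ∀ (v : V) (p : unitInterval), 0 < theta G v p →
    ∃ u : ℕ → ℕ, (∀ n, 4 * u n ≤ n) ∧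
      Tendsto (fun n => (bondPercolation G p).real (Φ.uniqueConn (hexBall Φ.centre n) (hexBall Φ.centre (u n)) (hexSphere Φ.centre n))) atTop (𝓝 1)

/-- **SUB-NODE — DST eq. (12) in hexagonal geometry, for sequences with `u_n ≤ n/4`** (otherwise verbatim `Eq12Likely` of «HexShadowTwoBlock»): for every
`u` as in eq. (1), every `ε > 0` and `N` there are an admissible `n ≥ N` (`period ∣ n`) and a side offset `y' = period·s ∈ [−3n, n]` with
`P_p[hexBall c u_{3n} ⟷^{hexBall c 4n} hexBall (c + 2n e₀ + y' e₁) u_n] > 1 − ε`.  Internal obligation, never asserted (it is what the hexagonal Gluing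
Lemma delivers, «HexShadowGluing»). [cite: DuminilCopinSidoraviciusTassion2016, §2.1 eq. (12)] -/
def Eq12Likely4 {V : Type} {G : SimpleGraph V} (Φ : HexShadow G) [Countable V] : Prop :=
  ∀ (v : V) (p : unitInterval), 0 < theta G v p → ∀ u : ℕ → ℕ, (∀ n, 4 * u n ≤ n) →
    Tendsto (fun n => (bondPercolation G p).real (Φ.uniqueConn (hexBall Φ.centre n) (hexBall Φ.centre (u n)) (hexSphere Φ.centre n))) atTop (𝓝 1) →
    ∀ ε : ℝ, 0 < ε → ∀ N : ℕ, ∃ n : ℕ, N ≤ n ∧ Φ.period ∣ n ∧ ∃ s : ℤ, -(3 * (n : ℤ)) ≤ Φ.period * s ∧ (Φ.period : ℤ) * s ≤ n ∧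
      1 - ε < (bondPercolation G p).real (Φ.conn (hexBall Φ.centre (4 * n)) (hexBall Φ.centre (u (3 * n)))
        (hexBall (Φ.centre + (2 * (n : ℤ)) • Pi.single 0 1 + ((Φ.period : ℤ) * s) • Pi.single 1 1) (u n)))

/-- **SUB-NODE A2 (eq. (13), face version) with `u_n ≤ n/4`** (otherwise verbatim `TwoBlockLikely` of «HexShadowFaceCriterion»).  Internal obligation, never
asserted (PROVED below from `Eq12Likely4`). [cite: DuminilCopinSidoraviciusTassion2016, §2.1 eq. (13)] -/
def TwoBlockLikely4 {V : Type} {G : SimpleGraph V} (Φ : HexShadow G) [Countable V] : Prop :=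
  ∀ (v : V) (p : unitInterval), 0 < theta G v p → ∀ u : ℕ → ℕ, (∀ n, 4 * u n ≤ n) →
    Tendsto (fun n => (bondPercolation G p).real (Φ.uniqueConn (hexBall Φ.centre n) (hexBall Φ.centre (u n)) (hexSphere Φ.centre n))) atTop (𝓝 1) →
    ∀ ε : ℝ, 0 < ε → ∀ N : ℕ, ∃ n : ℕ, N ≤ n ∧ Φ.period ∣ n ∧
      1 - ε < (bondPercolation G p).real
        (Φ.conn (hexBall (Φ.centre + (n : ℤ) • faceDir 0) (6 * n)) (hexBall Φ.centre (u (3 * n))) (hexBall (Φ.centre + (2 * (n : ℤ)) • faceDir 0) (u (3 * n))))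

/-! ## §3 The chain -/

/-- **Eq. (1) with `4 u_n ≤ n` from the a.s. uniqueness of the infinite cluster** (gen 31's `uniqueConnLikely_of_uniqueness` with the extraction
`exists_seq_tendsto_one_of_liminf_mul 4`). [cite: DuminilCopinSidoraviciusTassion2016, §2.1 eq. (1)] -/
theorem uniqueConnLikely4_of_uniqueness [Countable V] (hU : ∀ p : unitInterval, ∀ᵐ ω ∂(bondPercolation G p), numInfiniteClusters ω ≤ 1) :
    Φ.UniqueConnLikely4 := by
  intro v p hθ
  exact exists_seq_tendsto_one_of_liminf_mul 4
    (a := fun w n => (bondPercolation G p).real (Φ.uniqueConn (hexBall Φ.centre n) (hexBall Φ.centre w) (hexSphere Φ.centre n)))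
    (g := fun w => (bondPercolation G p).real (Φ.hexToInfinity w))
    (fun w n => measureReal_nonneg) (fun w n => measureReal_le_one) (fun w => measureReal_le_one)
    (fun w ε hε => Φ.le_eventually_real_uniqueConn (hU p) w hε) (Φ.tendsto_real_hexToInfinity hθ)

/-- A crossing over a hexagon is measurable (local copy). [folklore] -/
private theorem measurableSet_conn₁₄ (c : Site 2) (m : ℕ) (X Y : Set (Site 2)) : MeasurableSet (Φ.conn (hexBall c m) X Y) :=
  measurableSet_of_isLocalEvent_holds ⟨(finite_sym2 (Φ.lift_finite (hexBall_finite c m))).toFinset, by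
    rw [Set.Finite.coe_toFinset]; exact Φ.determinedBy_conn X Y subset_rfl⟩

/-- **EQ. (13) FROM EQ. (12), `u_n ≤ n/4`** (gen 31's `twoBlockLikely_of_eq12Likely` verbatim: the lifted side mirror about `c'`, the uniqueness block of
`B'` by eq. (1) and translation, `conn_of_glue`, union bound). [cite: DuminilCopinSidoraviciusTassion2016, §2.1 eqs. (12)–(13)] -/
theorem twoBlockLikely4_of_eq12Likely4 [Countable V] (h12 : Φ.Eq12Likely4) : Φ.TwoBlockLikely4 := by
  intro v p hθ u hu4 hlim ε hε N
  set P := bondPercolation G p with hP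
  have hε3 : 0 < ε / 3 := by positivity
  have hev : ∀ᶠ m in atTop, P.real (Φ.uniqueConn (hexBall Φ.centre m) (hexBall Φ.centre (u m)) (hexSphere Φ.centre m)) ∈ Set.Ioi (1 - ε / 3) :=
    hlim.eventually (Ioi_mem_nhds (show (1 : ℝ) - ε / 3 < 1 by linarith))
  obtain ⟨N₁, hN₁⟩ := Filter.eventually_atTop.1 hev
  obtain ⟨n, hn, hdvd, s, hs1, hs2, h12n⟩ := h12 v p hθ u hu4 hlim (ε / 3) hε3 (max N N₁)
  refine ⟨n, (le_max_left _ _).trans hn, hdvd, ?_⟩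
  set y : ℤ := (Φ.period : ℤ) * s with hy
  set D : Site 2 := (2 * (n : ℤ)) • Pi.single 0 1 + y • Pi.single 1 1 with hDdef
  set c' : Site 2 := Φ.centre + D with hc'
  obtain ⟨m, hm⟩ := hdvd
  set t : Site 2 := (2 * (m : ℤ)) • Pi.single 0 1 + s • Pi.single 1 1 with htdef
  have hDt : D = (Φ.period : ℤ) • t := by
    rw [hDdef, htdef, hy, hm, smul_add, smul_smul, smul_smul]; push_cast; ring_nf
  have hU : 1 - ε / 3 < P.real (Φ.uniqueConn (hexBall c' n) (hexBall c' (u n)) (hexSphere c' n)) := by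
    rw [hc', hDt, hP, Φ.real_uniqueConn_shift]
    exact hN₁ n ((le_max_right _ _).trans hn)
  obtain ⟨α, hα⟩ := Φ.exists_sideMirror_lift t
  rw [← hDt] at hα
  have hmc : sideMirrorAt c' Φ.centre = Φ.centre + (2 * (n : ℤ)) • faceDir 0 := by
    rw [sideMirrorAt_apply, hc', show Φ.centre - (Φ.centre + D) = -D by abel, add_assoc, hDdef, sideMirror_key]
  have hmc' : sideMirrorAt c' c' = c' := sideMirrorAt_self c'
  have hc'e : c' = Φ.centre + (2 * (n : ℤ)) • Pi.single 0 1 + y • Pi.single 1 1 := by rw [hc', hDdef, add_assoc]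
  have h12c : 1 - ε / 3 < P.real (Φ.conn (hexBall Φ.centre (4 * n)) (hexBall Φ.centre (u (3 * n))) (hexBall c' (u n))) := by
    rw [hc'e]; exact h12n
  have h12' : 1 - ε / 3 < P.real (Φ.conn (hexBall (Φ.centre + (2 * (n : ℤ)) • faceDir 0) (4 * n))
      (hexBall (Φ.centre + (2 * (n : ℤ)) • faceDir 0) (u (3 * n))) (hexBall c' (u n))) := by
    have key := Φ.real_conn_image α (sideMirrorAt c') (fun w => by rw [hα w]) p (hexBall Φ.centre (4 * n)) (hexBall Φ.centre (u (3 * n))) (hexBall c' (u n))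
    rw [image_sideMirrorAt_hexBall, image_sideMirrorAt_hexBall, image_sideMirrorAt_hexBall, hmc, hmc'] at key
    rw [key]; exact h12c
  have hun : u (3 * n) ≤ n := by have := hu4 (3 * n); omega
  obtain ⟨hT1, hT2, hB', hX, hX'⟩ := threeHex_geometry hun Φ.centre hs1 hs2
  have hglue : P.real (Φ.conn (hexBall Φ.centre (4 * n)) (hexBall Φ.centre (u (3 * n))) (hexBall c' (u n)) ∩
      Φ.conn (hexBall (Φ.centre + (2 * (n : ℤ)) • faceDir 0) (4 * n)) (hexBall (Φ.centre + (2 * (n : ℤ)) • faceDir 0) (u (3 * n))) (hexBall c' (u n)) ∩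
      Φ.uniqueConn (hexBall c' n) (hexBall c' (u n)) (hexSphere c' n)) ≤
      P.real (Φ.conn (hexBall (Φ.centre + (n : ℤ) • faceDir 0) (6 * n)) (hexBall Φ.centre (u (3 * n)))
        (hexBall (Φ.centre + (2 * (n : ℤ)) • faceDir 0) (u (3 * n)))) := by
    refine ENNReal.toReal_mono (measure_ne_top _ _) (measure_mono_ae ?_)
    filter_upwards [ProbabilityTheory.setBernoulli_ae_subset (u := G.edgeSet) (p := p)] with ω hω hmem
    have huu : hexBall c' (u n) ⊆ hexBall c' n := hexBall_mono _ (by have := hu4 n; omega)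
    exact Φ.conn_of_glue hω hT1 hT2 hB' huu hX hX' hmem.1.1 hmem.1.2 hmem.2
  have hAB := measureReal_inter_ge P (Φ.conn (hexBall Φ.centre (4 * n)) (hexBall Φ.centre (u (3 * n))) (hexBall c' (u n)))
    (Φ.measurableSet_conn₁₄ (Φ.centre + (2 * (n : ℤ)) • faceDir 0) (4 * n) (hexBall (Φ.centre + (2 * (n : ℤ)) • faceDir 0) (u (3 * n))) (hexBall c' (u n)))
  have hABC := measureReal_inter_ge P
    (Φ.conn (hexBall Φ.centre (4 * n)) (hexBall Φ.centre (u (3 * n))) (hexBall c' (u n)) ∩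
      Φ.conn (hexBall (Φ.centre + (2 * (n : ℤ)) • faceDir 0) (4 * n)) (hexBall (Φ.centre + (2 * (n : ℤ)) • faceDir 0) (u (3 * n))) (hexBall c' (u n)))
    (Φ.measurableSet_uniqueConn_hexBall c' n (hexBall c' (u n)) (hexSphere c' n))
  linarith

/-- **NODE A FROM eq. (1) and eq. (13) with `u_n ≤ n/4`** (gen 31's `faceGoodEventLikely_of_subnodes` verbatim).
[cite: DuminilCopinSidoraviciusTassion2016, §2.2 (p. 6)] -/
theorem faceGoodEventLikely_of_subnodes4 [Countable V] (h1 : Φ.UniqueConnLikely4) (h13 : Φ.TwoBlockLikely4) : Φ.FaceGoodEventLikely := by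
  intro v p hθ η hη
  obtain ⟨u, hu4, hlim⟩ := h1 v p hθ
  set P := bondPercolation G p with hP
  have hη3 : 0 < η / 3 := by positivity
  have hev : ∀ᶠ m in atTop, P.real (Φ.uniqueConn (hexBall Φ.centre m) (hexBall Φ.centre (u m)) (hexSphere Φ.centre m)) ∈ Set.Ioi (1 - η / 3) :=
    hlim.eventually (Ioi_mem_nhds (show (1 : ℝ) - η / 3 < 1 by linarith))
  obtain ⟨N₁, hN₁⟩ := Filter.eventually_atTop.1 hev
  obtain ⟨n, hn, hdvd, h13n⟩ := h13 v p hθ u hu4 hlim (η / 3) hη3 (max N₁ 1)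
  have hn1 : 1 ≤ n := (le_max_right _ _).trans hn
  have hN₁n : N₁ ≤ 3 * n := ((le_max_left _ _).trans hn).trans (by omega)
  refine ⟨n, u (3 * n), hn1, hdvd, by have := hu4 (3 * n); omega, ?_⟩
  have hii₀ : 1 - η / 3 < P.real (Φ.uniqueConn (hexBall Φ.centre (3 * n)) (hexBall Φ.centre (u (3 * n))) (hexSphere Φ.centre (3 * n))) := hN₁ (3 * n) hN₁n
  have hii₁ : 1 - η / 3 < P.real (Φ.uniqueConn (hexBall (Φ.centre + (2 * (n : ℤ)) • faceDir 0) (3 * n))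
      (hexBall (Φ.centre + (2 * (n : ℤ)) • faceDir 0) (u (3 * n))) (hexSphere (Φ.centre + (2 * (n : ℤ)) • faceDir 0) (3 * n))) := by
    obtain ⟨m, hm⟩ := hdvd
    have e : Φ.centre + (2 * (n : ℤ)) • faceDir 0 = Φ.centre + (Φ.period : ℤ) • ((2 * (m : ℤ)) • faceDir 0) := by
      rw [hm, smul_smul]; push_cast; ring_nf
    rw [e, hP, Φ.real_uniqueConn_shift]
    exact hii₀
  have hgood₀ : 1 - η < P.real (Φ.faceGoodEvent n (u (3 * n)) Φ.centre 0) := by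
    have hBC := measureReal_inter_ge P
      (Φ.uniqueConn (hexBall Φ.centre (3 * n)) (hexBall Φ.centre (u (3 * n))) (hexSphere Φ.centre (3 * n)))
      (Φ.measurableSet_uniqueConn_hexBall (Φ.centre + (2 * (n : ℤ)) • faceDir 0) (3 * n) (hexBall (Φ.centre + (2 * (n : ℤ)) • faceDir 0) (u (3 * n)))
        (hexSphere (Φ.centre + (2 * (n : ℤ)) • faceDir 0) (3 * n)))
    have hABC := measureReal_inter_ge P
      (Φ.conn (hexBall (Φ.centre + (n : ℤ) • faceDir 0) (6 * n)) (hexBall Φ.centre (u (3 * n))) (hexBall (Φ.centre + (2 * (n : ℤ)) • faceDir 0) (u (3 * n))))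
      ((Φ.measurableSet_uniqueConn_hexBall Φ.centre (3 * n) (hexBall Φ.centre (u (3 * n))) (hexSphere Φ.centre (3 * n))).inter
        (Φ.measurableSet_uniqueConn_hexBall (Φ.centre + (2 * (n : ℤ)) • faceDir 0) (3 * n) (hexBall (Φ.centre + (2 * (n : ℤ)) • faceDir 0) (u (3 * n)))
          (hexSphere (Φ.centre + (2 * (n : ℤ)) • faceDir 0) (3 * n))))
    unfold faceGoodEvent
    linarith
  intro i
  fin_cases i
  · exact hgood₀
  · show 1 - η < P.real (Φ.faceGoodEvent n (u (3 * n)) Φ.centre 1)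
    rw [hP, Φ.real_faceGoodEvent_one_eq]
    exact hgood₀

/-- **`θ_v(p_c) = 0` FROM `Eq12Likely4`** for a connected graph with a hexagonal shadow and a.s. uniqueness at every density.
[cite: DuminilCopinSidoraviciusTassion2016, Thm. 1 and §2] -/
theorem theta_criticalProb_eq_zero_of_eq12Likely4 [Countable V] (hG : G.Connected)
    (hU : ∀ p : unitInterval, ∀ᵐ ω ∂(bondPercolation G p), numInfiniteClusters ω ≤ 1) (h12 : Φ.Eq12Likely4) (v : V) :
    theta G v (criticalProbIOf G v) = 0 :=
  Φ.theta_criticalProb_eq_zero_of_faceNodes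
    (Φ.faceGoodEventLikely_of_subnodes4 (Φ.uniqueConnLikely4_of_uniqueness hU) (Φ.twoBlockLikely4_of_eq12Likely4 h12)) (Φ.faceRenormalisation hG) v

end HexShadow

/-- **THE `(111)`-FILM THEOREM MODULO `Eq12Likely4`** (`k ≥ 1`): Burton–Keane uniqueness for the film («Slab111Scope»), connectedness, and the chain above.
[cite: DuminilCopinSidoraviciusTassion2016, Thm. 1 and §2.1 eq. (12)] [cite: BenjaminiSchramm1996, Conj. 4 / Question 3] -/
theorem slab111OwnCriticalContinuity_of_eq12Likely4 {k : ℕ} (hk : 1 ≤ k) (h12 : (Slab111.hexShadow k).Eq12Likely4) : Slab111OwnCriticalContinuity k :=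
  fun v => (Slab111.hexShadow k).theta_criticalProb_eq_zero_of_eq12Likely4 (Slab111.connected hk)
    (fun p => BurtonKeane1989_atMostOneInfiniteCluster_holds (Slab111.film k) (Slab111.connected hk) (Slab111.isQuasiTransitive k) (Slab111.isGraphAmenable k) p)
    h12 v

end Summit.CriticalPhenomena.PercolationContinuityZ3.Theorems.Transplant

end
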